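import Summits.QuantumFields.YangMills.Theorems.UnitScaleTiltMinimiserStabilityRegPrOfB8Thm2AtT3Members
import Summits.QuantumFields.YangMills.Theorems.CoarseStiffnessTailHistoryTailOfUnitPolyTail
import HarnessLib

/-!
# Route `CoarseStiffnessTail` — ITS RUNG LEAF FROM ONE NAMED LITERATURE FACT, THE SHARED CRUX 20520 AND THE ROUTE'S OWN CRUX `UnitPolyTailL`, BY NAME:
# `YM3TorusSU2 ⟸ {B8Thm2AtT3Members, FluctuationComparisonRegPrIntL, UnitPolyTailL}` — the shared crux 19200 `MinimiserStabilityRegPr` leaves THIS route's cone too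

Cell `ym3-torus` ∕ HOME `pub/ideators/ym-r3-idea-2` (YM ladder rung R3 = continuum `SU(2)` Yang–Mills on T³ — a RUNG, NOT d = 4, NOT infinite volume, NOT a mass gap, NOT Clay);
seat `ym-line-cst-p1` g39 (the route's own line seat; base items stmt-QuantumFields-25301∕25302); `--supports stmt-QuantumFields-24027 --as helper`, count-neutral,
definition-free, default heartbeats; route ∕ registry untouched.

WHAT.  The route's deciding glue `Theses/CoarseStiffnessTail.lean` `closes (h200 : MinimiserStabilityRegPr) (h201 : FluctuationComparisonRegPrIntL) (hP : UnitPolyTailL)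
(hG : HistoryTailOfUnitPolyTail) : YM3TorusSU2` (:307) reads the SHARED cruxes 19200 ∕ 20520 (route-local copies of the `UnitScaleTilt` texts, definitionally equal) and the route's
own crux `UnitPolyTailL` (stmt-QuantumFields-24027) through the LANDED glue ✓p687579∕✓`CoarseStiffnessTailHistoryTailOfUnitPolyTail.historyTailOfUnitPolyTail_proof` (24029).
After ★★★ director-ym g19's channel (iii) the shared crux 19200 is a function of ONE NAMED LITERATURE FACT: ★p1 g30's ✓p793522
`MinimiserStabilityRegPrOfB8Thm2AtT3Members.minimiserStabilityRegPr_of_b8Thm2AtT3Members : B8Thm2AtT3Members → MinimiserStabilityRegPr` (✓p793328 `B8Thm2AtT3Members` =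
[Balaban1985RegularSpaces] Thm 2 at the members; (C1) PASS ×2).  Hence, BY NAME:
★★★ `ym3TorusSU2_of_b8Thm2AtT3Members_intL_unitPolyTailL (hX : B8Thm2AtT3Members) (h201 : FluctuationComparisonRegPrIntL) (hP : UnitPolyTailL) : YM3TorusSU2` — ONE TERM —
and `minimiserStabilityRegPr_route_of_b8Thm2AtT3Members` (the route-local copy of 19200 from the fact, by definitional unfolding).
READING: route-CoarseStiffnessTail's leaf reads {ONE Literature name (debt item, visible-unstaffed, RULING №65 (c)), crux 20520, crux 24027 `UnitPolyTailL`}; its 19200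
binder is gone (cf. the sister junction ✓p794677 for route `UnitScaleTilt`, where 19936's NODE-O row plays `UnitPolyTailL`'s part).

HONEST SCOPE (CREDIT NOTHING): a junction of landed theorems; `B8Thm2AtT3Members` (OPEN exactly at `L = 3`), `FluctuationComparisonRegPrIntL` (20520), `UnitPolyTailL` (24027, XL
organ stub `stub_topTailDegradedEv` open) — hence `YM3TorusSU2` — are NOT proved; `CappedCoarseStiffnessL` (25301) untouched; closes 0∕3; embargo-lite №58 untouched; rung R3 =
SU(2) YM₃ on T³ — NOT d = 4, NOT infinite volume, NOT a mass gap, NOT Clay; the Yang–Mills mass gap is NOT proved.  Sorry-free, axioms standard.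

References: T. Bałaban, CMP **99** (1985) 75–102 [Balaban1985RegularSpaces] (Thm 2 p.83); CMP **102** (1985) 255–275 [Balaban1985UV3] ((1)–(3) p.256, (5) p.256, (71) p.273);
CMP **122** (1989) 175–202 [Balaban1989LargeFieldI] (p.175); CMP **109** (1987) 249–301 [Balaban1987RG1] (§0 p.251).
-/

set_option autoImplicit false

noncomputable section

namespace Summit.QuantumFields.YangMills.Theorems.CoarseStiffnessTailYM3TorusSU2OfB8Thm2AtT3Members

open Literature.MathematicalPhysics.QuantumFieldTheory.Balaban1983to89
open Literature.MathematicalPhysics.QuantumFieldTheory.Balaban1983to89.T3YM3TorusStatement (YM3TorusSU2 YM3TorusSU2At)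
open Literature.MathematicalPhysics.QuantumFieldTheory.Balaban1983to89.T3B8Thm2AtMembers (B8Thm2AtT3Members)
open Summit.QuantumFields.YangMills.Theses.CoarseStiffnessTail (MinimiserStabilityRegPr FluctuationComparisonRegPrIntL UnitPolyTailL closes)
open Summit.QuantumFields.YangMills.Theorems.MinimiserStabilityRegPrOfB8Thm2AtT3Members (minimiserStabilityRegPr_of_b8Thm2AtT3Members)
open Summit.QuantumFields.YangMills.Theorems.CoarseStiffnessTailHistoryTailOfUnitPolyTail (historyTailOfUnitPolyTail_proof)

/-- **THE ROUTE-LOCAL COPY OF THE SHARED CRUX 19200 FROM THE NAMED FACT**: `CoarseStiffnessTail.MinimiserStabilityRegPr` (the same text as `UnitScaleTilt.MinimiserStabilityRegPr`,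
definitionally) ⟸ `B8Thm2AtT3Members`, by ★p1 g30's ✓`minimiserStabilityRegPr_of_b8Thm2AtT3Members`.  CONDITIONAL on the fact. [cite: Balaban1985RegularSpaces, Thm 2 p.83] -/
theorem minimiserStabilityRegPr_route_of_b8Thm2AtT3Members (hX : B8Thm2AtT3Members) : MinimiserStabilityRegPr :=
  minimiserStabilityRegPr_of_b8Thm2AtT3Members hX

/-- ★★★ **ROUTE `CoarseStiffnessTail`'s RUNG LEAF FROM ONE NAMED LITERATURE FACT, THE SHARED CRUX 20520 AND THE ROUTE's OWN CRUX 24027**: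
`YM3TorusSU2 ⟸ {B8Thm2AtT3Members, FluctuationComparisonRegPrIntL, UnitPolyTailL}` — the route's `closes` with `h200` fed by the fact and `hG` by the landed glue
✓`historyTailOfUnitPolyTail_proof` (24029); uniform `γ₁ = 1`.  CONDITIONAL on the three inputs. [cite: Balaban1985RegularSpaces, Thm 2 p.83; Balaban1985UV3, (1)-(3) p.256 and (71) p.273; Balaban1987RG1, §0 p.251] -/
theorem ym3TorusSU2_of_b8Thm2AtT3Members_intL_unitPolyTailL (hX : B8Thm2AtT3Members) (h201 : FluctuationComparisonRegPrIntL) (hP : UnitPolyTailL) :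
    YM3TorusSU2 :=
  closes (minimiserStabilityRegPr_route_of_b8Thm2AtT3Members hX) h201 hP historyTailOfUnitPolyTail_proof

/-- Every fixed-block leaf `YM3TorusSU2At L₀` from the same three inputs (lit ✓`YM3TorusSU2.at`). [cite: Balaban1985UV3, (1)-(3) p.256] -/
theorem ym3TorusSU2At_of_b8Thm2AtT3Members_intL_unitPolyTailL (L₀ : ℕ) (hX : B8Thm2AtT3Members) (h201 : FluctuationComparisonRegPrIntL) (hP : UnitPolyTailL) :
    YM3TorusSU2At L₀ :=
  (ym3TorusSU2_of_b8Thm2AtT3Members_intL_unitPolyTailL hX h201 hP).at L₀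

end Summit.QuantumFields.YangMills.Theorems.CoarseStiffnessTailYM3TorusSU2OfB8Thm2AtT3Members

end
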